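import Literature.NumberTheory.Sieve.PolynomialCongruencesPrimeModuli
import Literature.NumberTheory.Sieve.LiouvillePolynomialValues
import HarnessLib

/-!
# Property S for reducible quadratics — Teräväinen 2024, Prop. 2.11, the linear-factor case (PROVED)

Third sibling proof file (theorems only) of `LiouvillePolynomialValues.lean`
(`LiouvillePolynomialValuesProofs.lean`: Corollary 2.1, algebra; `…SmoothProofs.lean`:
Proposition 2.11 for `X² + 1`).  Source: J. Teräväinen, *On the Liouville function at polynomial
arguments*, Amer. J. Math. 146 (2024) = arXiv:2010.07924, Proposition 2.11 with Definition 2.9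
(property S) and the proof sketch of §7: "The case `P(n) = (a₁n + h₁)⋯(a_kn + h_k)` is easy, since
we may use the well-known fact that the set of numbers `n ≤ x` with a prime factor `> x^{1−ε}` has
density `o_{ε→0}(1)`, and combine this with the union bound."  For the quadratic clause of the
named fact `Literature.NumberTheory.Sieve.teravainen2024_prop_2_11_quadratic` this is the case of
a quadratic `P` REDUCIBLE over `ℚ`, and at the exponent `1` of property S it is even simpler than
printed: only `π(y) = O(y/log y)` (Chebyshev, Mathlib's `Chebyshev.eventually_primeCounting_le`)
is needed.

## What is PROVED

* `sq_den_mul_eval_eq` — for a rational root `u/v` of `P = aX² + bX + c`: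
  `v² P(n) = (vn − u)(avn + au + bv)` [folklore];
* `exists_eq_prime_mul_of_dvd_linear` — a prime `p > n ≥ 1` dividing `αn + β` (`α ≥ 1`) has
  cofactor `|k| ≤ α + |β|` [folklore];
* `card_not_smooth_le_of_rat_root` — hence `#{n ≤ x : P(n) has a prime factor > n} ≤
  2(2K+1)(π(Ax + B) + 1)` with `K, A, B` depending on `P` only (each exceptional `n` is recovered
  from the prime and the cofactor);
* `hasPropertyS_of_isRoot_rat` — **property S (with `η₀ = 1`) for every quadratic with positive
  leading coefficient and a rational root**: each progression `b (mod q)` has `≥ x/q − 2` members in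
  `[1, x]` and loses only `O(x/log x)` of them;
* `teravainen2024_prop_2_11_quadratic_of_irreducible` — **the named fact reduces to quadratics
  irreducible over `ℚ`** (the Harman case), via Mathlib's
  `Polynomial.irreducible_iff_roots_eq_zero_of_degree_le_three`.

The irreducible case in progressions is NOT proved in the tree (see the module docstring of
`LiouvillePolynomialValuesSmoothProofs.lean`: it needs a level of distribution beyond `x` for the
roots of a general irreducible quadratic); `teravainen2024_prop_2_11_quadratic` stays a named fact.

## References

* J. Teräväinen, Amer. J. Math. 146 (2024) 1115–1167, Def. 2.9, Prop. 2.11, §7. [Teravainen2024]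
-/

open Finset Real Filter Polynomial
open scoped Classical

noncomputable section

namespace Literature.NumberTheory.Sieve

/-! ### Step 1. A quadratic with a rational root: clearing denominators -/

-- `eval_eq_of_natDegree_eq_two` (a quadratic evaluates as `a n² + b n + c`) is the tree's, from
-- `PolynomialCongruencesPrimeModuli.lean`.

/-- If the quadratic `P = aX² + bX + c ∈ ℤ[X]` has the rational root `u/v` (lowest terms, `v ≥ 1`),
then `a u² + b u v + c v² = 0`. [folklore] -/
theorem coeff_rel_of_rat_root {P : ℤ[X]} (hdeg : P.natDegree = 2) {r : ℚ}
    (hr : (P.map (Int.castRingHom ℚ)).IsRoot r) :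
    P.coeff 2 * r.num ^ 2 + P.coeff 1 * r.num * r.den + P.coeff 0 * (r.den : ℤ) ^ 2 = 0 := by
  have h1 : (P.coeff 2 : ℚ) * r ^ 2 + (P.coeff 1 : ℚ) * r + (P.coeff 0 : ℚ) = 0 := by
    have h := hr
    rw [Polynomial.IsRoot, Polynomial.eval_map, Polynomial.eval₂_eq_sum_range, hdeg] at h
    simp [Finset.sum_range_succ] at h
    linear_combination h
  have h2 : (r.num : ℚ) = r * r.den := (Rat.mul_den_eq_num r).symm
  have h3 : ((P.coeff 2 * r.num ^ 2 + P.coeff 1 * r.num * r.den + P.coeff 0 * (r.den : ℤ) ^ 2 :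
      ℤ) : ℚ) = 0 := by
    push_cast
    rw [h2]
    have : (P.coeff 2 : ℚ) * (r * r.den) ^ 2 + (P.coeff 1 : ℚ) * (r * r.den) * r.den +
        (P.coeff 0 : ℚ) * (r.den : ℚ) ^ 2 =
        ((P.coeff 2 : ℚ) * r ^ 2 + (P.coeff 1 : ℚ) * r + (P.coeff 0 : ℚ)) * (r.den : ℚ) ^ 2 := by
      ring
    rw [this, h1, zero_mul]
  exact_mod_cast h3

/-- **Clearing denominators**: with a rational root `u/v` of the quadratic `P = aX² + bX + c`,
`v² P(n) = (v n − u)(a v n + a u + b v)` for every integer `n`. [folklore] -/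
theorem sq_den_mul_eval_eq {P : ℤ[X]} (hdeg : P.natDegree = 2) {r : ℚ}
    (hr : (P.map (Int.castRingHom ℚ)).IsRoot r) (n : ℤ) :
    (r.den : ℤ) ^ 2 * P.eval n =
      ((r.den : ℤ) * n - r.num) *
        (P.coeff 2 * r.den * n + (P.coeff 2 * r.num + P.coeff 1 * r.den)) := by
  rw [eval_eq_of_natDegree_eq_two hdeg]
  linear_combination coeff_rel_of_rat_root hdeg hr

/-! ### Step 2. A large prime factor of a linear form has a bounded cofactor -/

/-- If a prime `p > n ≥ 1` divides `α n + β` (`α ≥ 1`), then `α n + β = p k` with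
`|k| ≤ α + |β|`. [folklore] -/
theorem exists_eq_prime_mul_of_dvd_linear {α β : ℤ} (hα : 1 ≤ α) {n p : ℕ} (hn : 1 ≤ n)
    (hp : p.Prime) (hnp : n < p) (hdvd : (p : ℤ) ∣ α * n + β) :
    ∃ k : ℤ, |k| ≤ α + |β| ∧ α * n + β = p * k := by
  obtain ⟨k, hk⟩ := hdvd
  refine ⟨k, ?_, hk⟩
  have hp1 : (1 : ℤ) ≤ p := by exact_mod_cast hp.one_lt.le
  have hnp' : (n : ℤ) + 1 ≤ p := by exact_mod_cast hnp
  have hn' : (1 : ℤ) ≤ n := by exact_mod_cast hn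
  have habs : (p : ℤ) * |k| = |α * n + β| := by
    rw [hk, abs_mul, abs_of_nonneg (by linarith : (0 : ℤ) ≤ p)]
  have hle : |α * n + β| ≤ α * n + |β| := by
    calc |α * n + β| ≤ |α * n| + |β| := abs_add_le _ _
      _ = α * n + |β| := by rw [abs_of_nonneg (by nlinarith)]
  have hlt : (p : ℤ) * |k| < p * (α + |β|) := by
    have h1 : α * (n : ℤ) < α * p := by nlinarith
    have h2 : |β| ≤ (p : ℤ) * |β| := by nlinarith [abs_nonneg β]
    nlinarith
  have := lt_of_mul_lt_mul_left hlt (by linarith : (0 : ℤ) ≤ p)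
  linarith


/-! ### Step 3. Counting the exceptional `n` -/

/-- For a linear form `α n + β` (`α ≥ 1`) and a fixed cofactor `k`, the `1 ≤ n ≤ x` with
`α n + β = p k` for some prime `p` number at most `π(α x + |β|) + 1`: for `k ≠ 0` the prime
`p = (α n + β)/k ≤ α x + |β|` determines `n`; for `k = 0` there is at most one `n`. [folklore] -/
theorem card_filter_linear_eq_prime_mul_le {α β : ℤ} (hα : 1 ≤ α) (x : ℕ) (k : ℤ) :
    ((Finset.Icc 1 x).filter (fun n : ℕ => ∃ p : ℕ, p.Prime ∧ α * n + β = p * k)).card ≤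
      (Nat.primesLE (α.toNat * x + β.natAbs)).card + 1 := by
  set T := (Finset.Icc 1 x).filter (fun n : ℕ => ∃ p : ℕ, p.Prime ∧ α * n + β = p * k) with hT
  by_cases hk : k = 0
  · -- at most one `n` with `α n + β = 0`
    have : T.card ≤ 1 := by
      refine Finset.card_le_one.mpr fun n₁ hn₁ n₂ hn₂ => ?_
      rw [hT, Finset.mem_filter] at hn₁ hn₂
      obtain ⟨p₁, -, h₁⟩ := hn₁.2
      obtain ⟨p₂, -, h₂⟩ := hn₂.2
      rw [hk, mul_zero] at h₁ h₂
      have : α * (n₁ : ℤ) = α * n₂ := by linarith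
      exact_mod_cast mul_left_cancel₀ (by linarith : α ≠ 0) this
    omega
  · have hαnn : 0 ≤ α := by linarith
    have hM : ((α.toNat * x + β.natAbs : ℕ) : ℤ) = α * x + |β| := by
      push_cast [Int.toNat_of_nonneg hαnn]
      ring
    refine le_trans ?_ (Nat.le_succ _)
    refine Finset.card_le_card_of_injOn (fun n : ℕ => ((α * (n : ℤ) + β) / k).natAbs) ?_ ?_
    · intro n hn
      rw [Finset.mem_coe, hT, Finset.mem_filter, Finset.mem_Icc] at hn
      obtain ⟨⟨hn1, hnx⟩, p, hp, hpk⟩ := hn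
      have hdiv : (α * (n : ℤ) + β) / k = p := by rw [hpk, Int.mul_ediv_cancel _ hk]
      dsimp only
      rw [Finset.mem_coe, Nat.mem_primesLE]
      refine ⟨?_, by rw [hdiv, Int.natAbs_natCast]; exact hp⟩
      rw [hdiv, Int.natAbs_natCast]
      have hk1 : (1 : ℤ) ≤ |k| := Int.one_le_abs hk
      have hp0 : (0 : ℤ) ≤ p := by positivity
      have h1 : (p : ℤ) ≤ |α * n + β| := by
        rw [hpk, abs_mul, abs_of_nonneg hp0]
        nlinarith
      have h2 : |α * (n : ℤ) + β| ≤ α * x + |β| := by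
        calc |α * (n : ℤ) + β| ≤ |α * n| + |β| := abs_add_le _ _
          _ = α * n + |β| := by rw [abs_of_nonneg (by positivity)]
          _ ≤ α * x + |β| := by
              have : (n : ℤ) ≤ x := by exact_mod_cast hnx
              nlinarith
      have : (p : ℤ) ≤ ((α.toNat * x + β.natAbs : ℕ) : ℤ) := by rw [hM]; linarith
      exact_mod_cast this
    · intro n₁ hn₁ n₂ hn₂ heq
      rw [Finset.mem_coe, hT, Finset.mem_filter] at hn₁ hn₂
      obtain ⟨p₁, -, h₁⟩ := hn₁.2
      obtain ⟨p₂, -, h₂⟩ := hn₂.2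
      have hd₁ : (α * (n₁ : ℤ) + β) / k = p₁ := by rw [h₁, Int.mul_ediv_cancel _ hk]
      have hd₂ : (α * (n₂ : ℤ) + β) / k = p₂ := by rw [h₂, Int.mul_ediv_cancel _ hk]
      dsimp only at heq
      rw [hd₁, hd₂, Int.natAbs_natCast, Int.natAbs_natCast] at heq
      subst heq
      have : α * (n₁ : ℤ) = α * n₂ := by linarith
      exact_mod_cast mul_left_cancel₀ (by linarith : α ≠ 0) this

/-- **The exceptional set of a reducible quadratic.**  Let `P ∈ ℤ[X]` be quadratic with positive
leading coefficient and a rational root `u/v`.  If `n ≥ 1` and some prime `p > n` divides `P(n)`,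
then `p` divides one of the linear forms `v n − u`, `a v n + (a u + b v)` (`a, b` the top
coefficients), since `v² P(n)` is their product. [cite: Teravainen2024, §7, proof sketch of
Proposition 2.11 (linear-factor case)] -/
theorem exists_prime_dvd_linear_of_not_smooth {P : ℤ[X]} (hdeg : P.natDegree = 2) {r : ℚ}
    (hr : (P.map (Int.castRingHom ℚ)).IsRoot r) {n : ℕ}
    (hbad : ¬ ∀ p : ℕ, p.Prime → (p : ℤ) ∣ P.eval (n : ℤ) → p ≤ n) :
    ∃ p : ℕ, p.Prime ∧ n < p ∧
      ((p : ℤ) ∣ (r.den : ℤ) * n + (-r.num) ∨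
        (p : ℤ) ∣ P.coeff 2 * r.den * n + (P.coeff 2 * r.num + P.coeff 1 * r.den)) := by
  push Not at hbad
  obtain ⟨p, hp, hpd, hnp⟩ := hbad
  refine ⟨p, hp, hnp, ?_⟩
  have h : (p : ℤ) ∣ ((r.den : ℤ) * n - r.num) *
      (P.coeff 2 * r.den * n + (P.coeff 2 * r.num + P.coeff 1 * r.den)) := by
    rw [← sq_den_mul_eval_eq hdeg hr]
    exact hpd.mul_left _
  rw [sub_eq_add_neg] at h
  exact (Nat.prime_iff_prime_int.mp hp).dvd_or_dvd h

/-- **Few exceptions for a reducible quadratic**: with `K, A, B` depending only on `P`,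
`#{1 ≤ n ≤ x : some prime p > n divides P(n)} ≤ 2(2K + 1)(π(Ax + B) + 1)` for every `x`.
[cite: Teravainen2024, §7, proof sketch of Proposition 2.11 (linear-factor case)] -/
theorem card_not_smooth_le_of_rat_root {P : ℤ[X]} (hdeg : P.natDegree = 2)
    (hlc : 0 < P.leadingCoeff) {r : ℚ} (hr : (P.map (Int.castRingHom ℚ)).IsRoot r) :
    ∃ K A B : ℕ, ∀ x : ℕ,
      ((Finset.Icc 1 x).filter (fun n : ℕ =>
          ¬ ∀ p : ℕ, p.Prime → (p : ℤ) ∣ P.eval (n : ℤ) → p ≤ n)).card ≤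
        2 * (2 * K + 1) * ((Nat.primesLE (A * x + B)).card + 1) := by
  -- the two linear forms `α₁ n + β₁ = v n − u`, `α₂ n + β₂ = a v n + (a u + b v)`
  set a : ℤ := P.coeff 2 with ha
  set v : ℤ := (r.den : ℤ) with hv
  set α₂ : ℤ := a * v with hα₂
  set β₁ : ℤ := -r.num with hβ₁
  set β₂ : ℤ := a * r.num + P.coeff 1 * r.den with hβ₂
  have ha1 : 1 ≤ a := by
    have : P.leadingCoeff = P.coeff 2 := by rw [Polynomial.leadingCoeff, hdeg]
    rw [ha, ← this]; exact hlc
  have hv1 : 1 ≤ v := by rw [hv]; exact_mod_cast r.den_pos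
  have hα₂1 : 1 ≤ α₂ := by rw [hα₂]; nlinarith
  -- a common cofactor bound `K` and common size parameters `A x + B`
  obtain ⟨K, hK⟩ : ∃ K : ℕ, v + |β₁| ≤ K ∧ α₂ + |β₂| ≤ K :=
    ⟨(v + |β₁| + α₂ + |β₂|).toNat, by
      constructor <;>
      · have := Int.self_le_toNat (v + |β₁| + α₂ + |β₂|)
        linarith [abs_nonneg β₁, abs_nonneg β₂]⟩
  refine ⟨K, v.toNat + α₂.toNat, β₁.natAbs + β₂.natAbs, fun x => ?_⟩
  set M : ℕ := (v.toNat + α₂.toNat) * x + (β₁.natAbs + β₂.natAbs) with hM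
  set T₁ : ℤ → Finset ℕ := fun k =>
    (Finset.Icc 1 x).filter (fun n : ℕ => ∃ p : ℕ, p.Prime ∧ v * n + β₁ = p * k) with hT₁
  set T₂ : ℤ → Finset ℕ := fun k =>
    (Finset.Icc 1 x).filter (fun n : ℕ => ∃ p : ℕ, p.Prime ∧ α₂ * n + β₂ = p * k) with hT₂
  have hsub : ((Finset.Icc 1 x).filter (fun n : ℕ =>
      ¬ ∀ p : ℕ, p.Prime → (p : ℤ) ∣ P.eval (n : ℤ) → p ≤ n)) ⊆
      (Finset.Icc (-(K : ℤ)) K).biUnion T₁ ∪ (Finset.Icc (-(K : ℤ)) K).biUnion T₂ := by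
    intro n hn
    rw [Finset.mem_filter, Finset.mem_Icc] at hn
    obtain ⟨⟨hn1, hnx⟩, hbad⟩ := hn
    obtain ⟨p, hp, hnp, hdvd⟩ := exists_prime_dvd_linear_of_not_smooth hdeg hr hbad
    rw [Finset.mem_union, Finset.mem_biUnion, Finset.mem_biUnion]
    rcases hdvd with h | h
    · obtain ⟨k, hk, hke⟩ := exists_eq_prime_mul_of_dvd_linear hv1 hn1 hp hnp h
      left
      refine ⟨k, ?_, ?_⟩
      · rw [Finset.mem_Icc, ← abs_le]; exact hk.trans (by exact_mod_cast hK.1)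
      · rw [hT₁, Finset.mem_filter, Finset.mem_Icc]; exact ⟨⟨hn1, hnx⟩, p, hp, hke⟩
    · have h' : (p : ℤ) ∣ α₂ * n + β₂ := by rw [hα₂, hβ₂]; convert h using 1
      obtain ⟨k, hk, hke⟩ := exists_eq_prime_mul_of_dvd_linear hα₂1 hn1 hp hnp h'
      right
      refine ⟨k, ?_, ?_⟩
      · rw [Finset.mem_Icc, ← abs_le]; exact hk.trans (by exact_mod_cast hK.2)
      · rw [hT₂, Finset.mem_filter, Finset.mem_Icc]; exact ⟨⟨hn1, hnx⟩, p, hp, hke⟩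
  -- sizes of the pieces
  have hmono : ∀ {M' : ℕ}, M' ≤ M → (Nat.primesLE M').card + 1 ≤ (Nat.primesLE M).card + 1 :=
    fun h => Nat.succ_le_succ (Finset.card_le_card fun p hp => by
      rw [Nat.mem_primesLE] at hp ⊢; exact ⟨hp.1.trans h, hp.2⟩)
  have hv0 : 0 ≤ v := by linarith
  have hα₂0 : 0 ≤ α₂ := by linarith
  have hT₁card : ∀ k, (T₁ k).card ≤ (Nat.primesLE M).card + 1 := fun k =>
    (card_filter_linear_eq_prime_mul_le hv1 x k).trans (hmono (by
      rw [hM]; gcongr <;> simp))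
  have hT₂card : ∀ k, (T₂ k).card ≤ (Nat.primesLE M).card + 1 := fun k =>
    (card_filter_linear_eq_prime_mul_le hα₂1 x k).trans (hmono (by
      rw [hM]; gcongr <;> simp))
  have hIcc : (Finset.Icc (-(K : ℤ)) K).card = 2 * K + 1 := by
    rw [Int.card_Icc]; omega
  calc ((Finset.Icc 1 x).filter (fun n : ℕ =>
          ¬ ∀ p : ℕ, p.Prime → (p : ℤ) ∣ P.eval (n : ℤ) → p ≤ n)).card
      ≤ ((Finset.Icc (-(K : ℤ)) K).biUnion T₁ ∪ (Finset.Icc (-(K : ℤ)) K).biUnion T₂).card :=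
        Finset.card_le_card hsub
    _ ≤ ((Finset.Icc (-(K : ℤ)) K).biUnion T₁).card + ((Finset.Icc (-(K : ℤ)) K).biUnion T₂).card :=
        Finset.card_union_le _ _
    _ ≤ ∑ k ∈ Finset.Icc (-(K : ℤ)) K, (T₁ k).card + ∑ k ∈ Finset.Icc (-(K : ℤ)) K, (T₂ k).card :=
        add_le_add Finset.card_biUnion_le Finset.card_biUnion_le
    _ ≤ ∑ _k ∈ Finset.Icc (-(K : ℤ)) K, ((Nat.primesLE M).card + 1) +
          ∑ _k ∈ Finset.Icc (-(K : ℤ)) K, ((Nat.primesLE M).card + 1) :=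
        add_le_add (Finset.sum_le_sum fun k _ => hT₁card k) (Finset.sum_le_sum fun k _ => hT₂card k)
    _ = 2 * (2 * K + 1) * ((Nat.primesLE M).card + 1) := by
        rw [Finset.sum_const, hIcc, smul_eq_mul]; ring


/-! ### Step 4. Progressions, Chebyshev's bound, and property S -/

/-- A progression `n ≡ b (mod q)` (`q ≥ 1`) has at least `⌊x/q⌋ − 1` members in `[1, x]`
(the members `b mod q + qj`, `1 ≤ j ≤ ⌊x/q⌋ − 1`). [folklore] -/
theorem sub_one_le_card_filter_mod (x q b : ℕ) (hq : 1 ≤ q) :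
    x / q - 1 ≤ ((Finset.Icc 1 x).filter (fun n : ℕ => n % q = b % q)).card := by
  have hcard : (Finset.Icc 1 (x / q - 1)).card = x / q - 1 := by simp
  rw [← hcard]
  refine Finset.card_le_card_of_injOn (fun j => b % q + q * j) ?_ ?_
  · intro j hj
    rw [Finset.mem_coe, Finset.mem_Icc] at hj
    dsimp only
    rw [Finset.mem_coe, Finset.mem_filter, Finset.mem_Icc]
    have hbq : b % q < q := Nat.mod_lt _ (by omega)
    have hxq : 1 ≤ x / q := by omega
    have h1 : q * j + q ≤ q * (x / q) := by
      have := Nat.mul_le_mul_left q (show j + 1 ≤ x / q by omega)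
      rwa [mul_add, mul_one] at this
    have h2 : q * (x / q) ≤ x := Nat.mul_div_le x q
    have h3 : q ≤ q * j := Nat.le_mul_of_pos_right q (by omega)
    refine ⟨⟨by omega, by omega⟩, ?_⟩
    rw [Nat.add_mul_mod_self_left, Nat.mod_mod]
  · intro j₁ _ j₂ _ h
    have : q * j₁ = q * j₂ := by simpa using h
    exact Nat.eq_of_mul_eq_mul_left (by omega) this

/-- Real form: `#{1 ≤ n ≤ x : n ≡ b (mod q)} ≥ x/q − 2`. [folklore] -/
theorem sub_two_le_card_filter_mod (x q b : ℕ) (hq : 1 ≤ q) :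
    (x : ℝ) / q - 2 ≤ (((Finset.Icc 1 x).filter (fun n : ℕ => n % q = b % q)).card : ℝ) := by
  have h := sub_one_le_card_filter_mod x q b hq
  have hq0 : (0 : ℝ) < q := by exact_mod_cast (by omega : 0 < q)
  have hdiv : (x : ℝ) / q - 1 < ((x / q : ℕ) : ℝ) := by
    have hlt : x < x / q * q + q := Nat.lt_div_mul_add (by omega)
    have hlt' : (x : ℝ) < ((x / q : ℕ) : ℝ) * q + q := by exact_mod_cast hlt
    rw [div_sub_one hq0.ne', div_lt_iff₀ hq0]
    linarith
  have hsub : ((x / q : ℕ) : ℝ) - 1 ≤ ((x / q - 1 : ℕ) : ℝ) := by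
    rcases Nat.eq_zero_or_pos (x / q) with h0 | hpos
    · rw [h0]; norm_num
    · rw [Nat.cast_sub hpos]; norm_num
  have hcast : ((x / q - 1 : ℕ) : ℝ) ≤
      (((Finset.Icc 1 x).filter (fun n : ℕ => n % q = b % q)).card : ℝ) := by exact_mod_cast h
  linarith

/-- **Teräväinen 2024, Proposition 2.11 for reducible quadratics** ("the case
`P(n) = (a₁n + h₁)⋯(a_kn + h_k)` is easy", §7): a quadratic `P ∈ ℤ[x]` with positive leading
coefficient and a rational root has property S — indeed `P(n)` is `n`-smooth for all but
`O(x/log x)` of the `n ≤ x` (a prime `p > n` dividing `P(n)` divides one of two fixed linear forms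
with bounded cofactor, `card_not_smooth_le_of_rat_root`, and there are only `π(Ax + B) ≪ x/log x`
primes available, Chebyshev), so every progression `b (mod q)` retains density `1/q`; `η₀ = 1`.
[cite: Teravainen2024, Proposition 2.11 and §7 (linear-factor case)] -/
theorem hasPropertyS_of_isRoot_rat {P : ℤ[X]} (hdeg : P.natDegree = 2)
    (hlc : 0 < P.leadingCoeff) {r : ℚ} (hr : (P.map (Int.castRingHom ℚ)).IsRoot r) :
    HasPropertyS P := by
  obtain ⟨K, A, B, hbad⟩ := card_not_smooth_le_of_rat_root hdeg hlc hr
  refine ⟨1, one_pos, fun q b hq _hb η hη => ?_⟩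
  have hq0 : (0 : ℝ) < q := by exact_mod_cast (by omega : 0 < q)
  set δ : ℝ := 1 / q - η with hδ
  have hδ0 : 0 < δ := by rw [hδ]; linarith
  -- constants
  set c : ℕ := A + B + 1 with hc
  have hc1 : (1 : ℝ) ≤ c := by rw [hc]; exact_mod_cast Nat.le_add_left 1 (A + B)
  set K' : ℝ := 2 * (2 * K + 1) with hK'
  have hK'0 : 0 < K' := by rw [hK']; positivity
  -- Chebyshev at the points `c x`
  have hcheb : ∀ᶠ x : ℕ in atTop,
      (Nat.primeCounting (c * x) : ℝ) ≤ (Real.log 4 + 1) * (c * x) / Real.log (c * x) := by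
    have hT : Tendsto (fun x : ℕ => ((c * x : ℕ) : ℝ)) atTop atTop := by
      refine tendsto_natCast_atTop_atTop.comp ?_
      exact Filter.tendsto_id.const_mul_atTop' (by omega : 0 < c)
    have h := hT.eventually (Chebyshev.eventually_primeCounting_le one_pos)
    filter_upwards [h] with x hx
    rw [Nat.floor_natCast] at hx
    exact_mod_cast hx
  have hlog : ∀ᶠ x : ℕ in atTop, 2 * K' * ((Real.log 4 + 1) * c) / δ ≤ Real.log x :=
    (Real.tendsto_log_atTop.comp tendsto_natCast_atTop_atTop).eventually_ge_atTop _
  have hlin : ∀ᶠ x : ℕ in atTop, 2 * (2 + K') / δ ≤ (x : ℝ) :=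
    tendsto_natCast_atTop_atTop.eventually_ge_atTop _
  have hx2 : ∀ᶠ x : ℕ in atTop, 2 ≤ x := eventually_ge_atTop 2
  have key : ∀ᶠ x : ℕ in atTop, η * (x : ℝ) ≤ (((Finset.Icc 1 x).filter (fun n : ℕ =>
      n % q = b % q ∧ ∀ p : ℕ, p.Prime → (p : ℤ) ∣ P.eval (n : ℤ) → p ≤ n)).card : ℝ) := by
    filter_upwards [hcheb, hlog, hlin, hx2] with x h1 h2 h3 h4
    have hx0 : (0 : ℝ) < x := by exact_mod_cast (by omega : 0 < x)
    have hlogx : 0 < Real.log x := Real.log_pos (by exact_mod_cast (by omega : 1 < x))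
    -- good ⊇ progression \ bad
    set good := (Finset.Icc 1 x).filter (fun n : ℕ =>
      n % q = b % q ∧ ∀ p : ℕ, p.Prime → (p : ℤ) ∣ P.eval (n : ℤ) → p ≤ n) with hgood
    set ap := (Finset.Icc 1 x).filter (fun n : ℕ => n % q = b % q) with hap
    set bad := (Finset.Icc 1 x).filter (fun n : ℕ =>
      ¬ ∀ p : ℕ, p.Prime → (p : ℤ) ∣ P.eval (n : ℤ) → p ≤ n) with hbadset
    have hcard : ap.card ≤ good.card + bad.card := by
      calc ap.card ≤ (ap \ bad).card + bad.card := Finset.card_le_card_sdiff_add_card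
        _ ≤ good.card + bad.card := by
          gcongr
          intro n hn
          rw [Finset.mem_sdiff, hap, hbadset, Finset.mem_filter, Finset.mem_filter] at hn
          rw [hgood, Finset.mem_filter]
          exact ⟨hn.1.1, hn.1.2, by simpa [hn.1.1] using hn.2⟩
    have hap_ge := sub_two_le_card_filter_mod x q b hq
    have hbad_le := hbad x
    -- π(Ax + B) ≤ π(cx) ≤ (log 4 + 1) c x / log x
    have hπ : ((Nat.primesLE (A * x + B)).card : ℝ) ≤ (Real.log 4 + 1) * c * x / Real.log x := by
      have hmono : (Nat.primesLE (A * x + B)).card ≤ Nat.primeCounting (c * x) := by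
        rw [Nat.primesLE_card_eq_primeCounting]
        exact Nat.monotone_primeCounting (by rw [hc]; nlinarith)
      have hcx : (x : ℝ) ≤ c * x := le_mul_of_one_le_left hx0.le hc1
      have hlogcx : Real.log x ≤ Real.log (c * x) := Real.log_le_log hx0 hcx
      calc ((Nat.primesLE (A * x + B)).card : ℝ) ≤ (Nat.primeCounting (c * x) : ℝ) := by
            exact_mod_cast hmono
        _ ≤ (Real.log 4 + 1) * (c * x) / Real.log (c * x) := h1
        _ ≤ (Real.log 4 + 1) * (c * x) / Real.log x := by
            apply div_le_div_of_nonneg_left _ hlogx hlogcx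
            have : 0 < Real.log 4 + 1 := by positivity
            positivity
        _ = (Real.log 4 + 1) * c * x / Real.log x := by ring
    -- the bad set is ≤ δ x / 2 + (stuff) ...
    have hbadR : (bad.card : ℝ) ≤ K' * ((Real.log 4 + 1) * c * x / Real.log x + 1) := by
      have : (bad.card : ℝ) ≤ (2 * (2 * K + 1) * ((Nat.primesLE (A * x + B)).card + 1) : ℕ) := by
        exact_mod_cast hbad_le
      refine this.trans ?_
      push_cast
      rw [hK']
      gcongr
    have hfrac : K' * ((Real.log 4 + 1) * c * x / Real.log x) ≤ δ / 2 * x := by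
      rw [show K' * ((Real.log 4 + 1) * c * x / Real.log x) =
        (K' * ((Real.log 4 + 1) * c) / Real.log x) * x by field_simp]
      apply mul_le_mul_of_nonneg_right _ hx0.le
      rw [div_le_iff₀ hlogx]
      have := (div_le_iff₀ hδ0).mp h2
      nlinarith
    have hconst : 2 + K' ≤ δ / 2 * x := by
      have := (div_le_iff₀ hδ0).mp h3
      nlinarith
    have hcardR : (ap.card : ℝ) ≤ good.card + bad.card := by exact_mod_cast hcard
    have : η * (x : ℝ) = (x : ℝ) / q - δ * x := by rw [hδ]; ring
    rw [this]
    nlinarith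
  obtain ⟨x₀, hx₀⟩ := eventually_atTop.mp key
  exact ⟨x₀, fun x hx => hx₀ x hx⟩


/-- **Reduction of the named fact to the irreducible case.**  Since reducible quadratics are
settled (`hasPropertyS_of_isRoot_rat`) and a quadratic over `ℚ` without rational roots is
irreducible (`Polynomial.irreducible_iff_roots_eq_zero_of_degree_le_three`), Teräväinen's
Proposition 2.11 (quadratic clause) follows from its case of quadratics irreducible over `ℚ` —
the case the paper refers to Harman's half-dimensional sieve.
[cite: Teravainen2024, Proposition 2.11 and §7] -/
theorem teravainen2024_prop_2_11_quadratic_of_irreducible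
    (h : ∀ P : ℤ[X], P.natDegree = 2 → 0 < P.leadingCoeff →
      Irreducible (P.map (Int.castRingHom ℚ)) → HasPropertyS P) :
    teravainen2024_prop_2_11_quadratic := by
  intro P hdeg hlc
  by_cases hroot : ∃ r : ℚ, (P.map (Int.castRingHom ℚ)).IsRoot r
  · obtain ⟨r, hr⟩ := hroot
    exact hasPropertyS_of_isRoot_rat hdeg hlc hr
  · refine h P hdeg hlc ?_
    have hdeg' : (P.map (Int.castRingHom ℚ)).natDegree = 2 := by
      rw [Polynomial.natDegree_map_eq_of_injective Int.cast_injective, hdeg]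
    rw [Polynomial.irreducible_iff_roots_eq_zero_of_degree_le_three (by omega) (by omega),
      Multiset.eq_zero_iff_forall_notMem]
    intro r hr
    have h0 : P.map (Int.castRingHom ℚ) ≠ 0 := by
      intro h0; rw [h0, Polynomial.natDegree_zero] at hdeg'; omega
    exact hroot ⟨r, (Polynomial.mem_roots h0).mp hr⟩

end Literature.NumberTheory.Sieve

end
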